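import Summits.QuantumFields.YangMills.Theorems.BalabanUVNodesN17AtU3OfKernels
import Summits.QuantumFields.YangMills.Theorems.BalabanUVNodesN17AtRecord13SharedStub
import Literature.MathematicalPhysics.QuantumFieldTheory.Balaban1983to89.T4ContinuumYM4Torus

/-!
# BalabanUVNodes ∕ node N17 = NE4 — THE N17 CONJUNCT OF K3⁷ v4's `KeyedRatesHolderD4` UNDER THE FULL-PREFIX ∕ `ForSmallCouplings` KEY:
# what the keyed rates DELIVER at a tuple (the K2-junction witness; under the node-U3 pin the BARE scale-shift sentence) and what they READ
# («(t9) is IDLE on N17»: the FSC key changes the N17 slot by EXACTLY the two antecedents (B) ∧ endpoint existence, nothing in the tuning)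

Cell `pub-ymgap` (HUMAN RULINGS D-0062 ∕ D-0149, director-ym №197), WIDTH SEAT `pub-ymgap-dag-n17-w3` (seat 3 of 3 on NODE n17), generation 3; bus CLAIM-1 ∕ INTENT-1
(pub-ymgap INBOX l.27947).  THEOREMS ONLY (0 `def`, 0 `instance`, 0 `notation`, 0 `sorry`); filed `--kind proof --supports stmt-QuantumFields-20544 --as helper` (K3⁷
`SpineGivenEndpointR13SepCoPH`); COUNT-NEUTRAL.  Skeleton of record: plan g82's K3⁷ **v4** `HOME/pub-ymgap-plan/D82-K3V4/K3Skeleton13SepCoPHv4.lean` 17c74fac127b5f61 (not a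
tree module — its bodies are SPELLED here, nothing imported from `Theses/` or `Cruxes/`).

THE POINT (numbers, not adjectives).  v4's (t9)∕№204 re-key asks the K4 rates `PHolderD4 β D R := RatesHolderAt D R β ∧ ReadOutAt D R.u3 ∧ (0 ≤ R.u3.ρ ∧ R.u3.ρ < 1)`
at the reading `R := rr F θ hP g₀ os` ONLY UNDER THE CRUX's OWN PREFIX `(B) → EndpointExistence → ForSmallCouplings D (fun g₀ => ∀ os, …)` (skeleton :217), where v1–v3
asked them at EVERY bare sequence `g₀`.  For node N17 this file records, in the kernel, what that changes:
* DELIVERY (§2).  dag-n17-w1's v2∕v3 junction `…N17AtRecord13SharedStub.n17AtRecord13Guarded_of_keyedRatesHolderD4` read the ∀-`g₀` rates AT `(g₀, os) := (0, [])`; under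
  the FSC key that instantiation is gone (the zero bare sequence is not `D.Tuned`).  The v4 edition: the keyed rates STILL deliver the (A3-ii) K2-junction sentence
  `∃ u : U3Carriers, u.γ = θ.γ ∧ 0 ≤ u.ρ ∧ u.ρ < 1 ∧ N17At (datumOfRecord₁₃SepCoPH F N θ hP) u` at every guarded admissible tuple — NOW PRICED AT THE TWO ANTECEDENTS
  (B) `B16.EndStatementBPrinted D.C` and `DagBinding.EndpointExistence D.C.toB12` at that tuple: endpoint existence supplies ONE tuned sequence `g₀`
  (`T4Continuum.FiniteEpsData.exists_tuned`, [Balaban1987RG1] Thm 2 p. 259), and the witness is `u := (rr F θ hP.toCore g₀ []).u3` (§1's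
  `exists_of_forSmallCouplings`).
* READING (§3).  Under v3∕v4's node-U3 pin `U3PinnedKernels 𝔯 ℓ` (skeleton :245, spelled as the hypothesis `hpin`) the N17 conjunct at the bundle of record reads
  `ScaleShiftRate ((ℓ F θ).cr·(ℓ F θ).C₅·(ℓ F θ).θ₅) (ℓ F θ).ρ θ.γ (betaOfRecord₁₃ F N θ.toStage13Params)` (dag-n17-w1 `n17At_rateCarriers_of_kernels_pin_iff`) — a
  sentence that reads NEITHER `g₀` NOR `os` NOR the run-length selector (node U3's letter block is K-UNIFORM, `Node00.U3Letters₁₁`; the box radius IS `θ.γ`, `rfl`).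
  Hence (§1's `forSmallCouplings_const_iff`): under the pin and the two antecedents, v4's FSC-keyed N17 slot at a tuple ⟺ the BARE v3 sentence
  (`keyedN17_fsc_iff_bare_of_pin`), and the whole v4 stub-1 ∃-shape delivers SOME letter reading `ℓ` with the bare sentence at every guarded admissible tuple with
  (B) ∧ endpoint (`exists_letters_scaleShiftRate_of_stub_rates13H_shape_v4`).  LOCATED, said once: the tuning radius `γ ≤ γ₀` bound INSIDE `ForSmallCouplings` is a
  different binder from N17's box radius `θ.γ`, and `ScaleShiftRate` only weakens as the radius shrinks (`T4BetaReadOut.scaleShiftRate_mono`) — «γ, g as small as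
  needed» (v4 header) buys the N17 conjunct NOTHING; what (t9) changes for N17 is exactly the two antecedents.
* GENERIC (§1, any `FiniteEpsData`).  The const-conclusion faces `T4ContinuumYM4Torus` lacks (it has `.mono ∕ .of_forall ∕ .of_no_tuned ∕ .and ∕ .and_iff ∕ .toE`):
  `ForSmallCouplings D (fun _ => Q) ↔ Q` under endpoint existence, the `Q ∧ c g₀` split, extraction of one tuned sequence carrying the conclusion, and the honesty
  face `ForSmallCouplings D (fun _ => False) → ¬ EndpointExistence D.C.toB12` (WITHOUT the antecedent an FSC-keyed face may hold by vacuity — `ForSmallCouplings.of_no_tuned`).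
  Any K3⁷ seat whose v3 face is `g₀`-blind cites §1 the same way.

HONEST SCOPE (A6, director-ym №189).  Elementary quantifier bookkeeping over hypothesis SHAPES plus two tree faces by name; every hypothesis below is 0∕1-inhabited at
every record today (K0⁷ OPEN: no guarded admissible Stage-13 tuple is constructed; (B), endpoint existence, the K4 rates are HYPOTHESES); NE4 is NOT PRINTED
([Balaban1987RG1] p. 264 «We will investigate other properties in a separate paper») and NOT proved; nothing of Bałaban's is asserted; N17 NOT discharged; K3⁷ OPEN
(v4, 2 registered stubs, 0 closed) and NOT claimed; no skeleton text touched; counts UNMOVED (typed 28∕28 · discharged 5∕27 · A 5∕28).  One finite four-torus programme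
at fixed `ε = L^{−K}`; R4 closes the CONDITIONAL finite-𝕋⁴ rung `BalabanLadder.UV` only — NOT continuum ∕ ℝ⁴ ∕ infinite volume ∕ OS ∕ mass gap; the YM mass gap (Clay)
is NOT proved by any of this.  Standard axioms.  Supersedes nothing; edits nothing; no decl below carries a cite tag of its own (bookkeeping ∕ folklore).
-/

namespace YMDAG.N17.KeyedRatesFSC

open Literature.MathematicalPhysics.QuantumFieldTheory.Balaban1983to89
open Literature.MathematicalPhysics.QuantumFieldTheory.Balaban1983to89.T4Continuum
open Literature.MathematicalPhysics.QuantumFieldTheory.Balaban1983to89.T4ContinuumYM4Torus (ForSmallCouplings ForSmallCouplingsE)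
open Literature.MathematicalPhysics.QuantumFieldTheory.Balaban1983to89.T4CouplingMatching (ScaleShiftRate)
open Literature.MathematicalPhysics.QuantumFieldTheory.Balaban1983to89.Node00
open Node00.U3OfKernels (objectsOfRecord₁₃)
open YMDAG.UVSplit (Datum U3Carriers RateCarriers N17At N18At ReadOutAt RateReading₁₃CoPH rateCarriersOfRecord₁₃CoPH u3OfRecord₁₃)
open Summit.QuantumFields.YangMills.BalabanUVNodes.SpineRatesHolder (RatesHolderAt)
open Summit.QuantumFields.YangMills.Theorems.BalabanUVNodesN17AtRecord13SharedStub (exists_u3_n17At_of_pHolderD4)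
open YMDAG.N17.AtU3OfKernels (n17At_rateCarriers_of_kernels_pin_iff)

/-! ## §1 GENERIC: const-conclusion faces of the discharged prefix `ForSmallCouplings` (any finite-ε data `D`) -/

section Generic

universe u

variable {F : T4Family} {G : Type u} [GaugeGroup G] [MeasurableSpace G] [HaarData G] {D : FiniteEpsData F G}

/-- **ONE TUNED SEQUENCE CARRYING THE CONCLUSION, from the ∃-form**: read `ForSmallCouplingsE D c` at its own thresholds `(γ, g) := (γ₀, g₁)`. [folklore] -/
theorem exists_tuned_and_of_forSmallCouplingsE {c : (ℕ → ℝ) → Prop} (h : ForSmallCouplingsE D c) :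
    ∃ (γ g : ℝ) (g₀ : ℕ → ℝ), 0 < γ ∧ 0 < g ∧ D.Tuned γ g g₀ ∧ c g₀ := by
  obtain ⟨γ₀, hγ₀, H⟩ := h
  obtain ⟨g₁, hg₁, Hg⟩ := H γ₀ hγ₀ le_rfl
  obtain ⟨g₀, ht, hc⟩ := Hg g₁ hg₁ le_rfl
  exact ⟨γ₀, g₁, g₀, hγ₀, hg₁, ht, hc⟩

/-- **ONE TUNED SEQUENCE CARRYING THE CONCLUSION, from the ∀-form UNDER ENDPOINT EXISTENCE** ([Balaban1987RG1] Thm 2 p. 259: tuned bare couplings exist for all small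
`γ`, `g` — the tree's `ForSmallCouplings.toE`). [folklore] -/
theorem exists_tuned_and_of_forSmallCouplings {c : (ℕ → ℝ) → Prop} (hex : DagBinding.EndpointExistence D.C.toB12) (h : ForSmallCouplings D c) :
    ∃ (γ g : ℝ) (g₀ : ℕ → ℝ), 0 < γ ∧ 0 < g ∧ D.Tuned γ g g₀ ∧ c g₀ :=
  exists_tuned_and_of_forSmallCouplingsE (h.toE hex)

/-- … forgetting the tuning: under endpoint existence an FSC-keyed conclusion holds at SOME bare sequence. [folklore] -/
theorem exists_of_forSmallCouplings {c : (ℕ → ℝ) → Prop} (hex : DagBinding.EndpointExistence D.C.toB12) (h : ForSmallCouplings D c) : ∃ g₀ : ℕ → ℝ, c g₀ := by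
  obtain ⟨-, -, g₀, -, -, -, hc⟩ := exists_tuned_and_of_forSmallCouplings hex h
  exact ⟨g₀, hc⟩

/-- **A `g₀`-BLIND CONCLUSION UNDER THE PREFIX IS THE CONCLUSION** (given endpoint existence). [folklore] -/
theorem of_forSmallCouplings_const {Q : Prop} (hex : DagBinding.EndpointExistence D.C.toB12) (h : ForSmallCouplings D fun _ => Q) : Q := by
  obtain ⟨-, hQ⟩ := exists_of_forSmallCouplings hex h
  exact hQ

/-- ★ **THE CONST-CONCLUSION FACE**: under endpoint existence, `ForSmallCouplings D (fun _ => Q) ↔ Q` (← is `ForSmallCouplings.of_forall`, no hypothesis). [folklore] -/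
theorem forSmallCouplings_const_iff {Q : Prop} (hex : DagBinding.EndpointExistence D.C.toB12) : ForSmallCouplings D (fun _ => Q) ↔ Q :=
  ⟨of_forSmallCouplings_const hex, fun hQ => ForSmallCouplings.of_forall fun _ => hQ⟩

/-- **SPLITTING OFF A `g₀`-BLIND CONJUNCT**: under endpoint existence, `ForSmallCouplings D (fun g₀ => Q ∧ c g₀) ↔ Q ∧ ForSmallCouplings D c`. [folklore] -/
theorem forSmallCouplings_const_and_iff {Q : Prop} {c : (ℕ → ℝ) → Prop} (hex : DagBinding.EndpointExistence D.C.toB12) :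
    ForSmallCouplings D (fun g₀ => Q ∧ c g₀) ↔ Q ∧ ForSmallCouplings D c := by
  rw [ForSmallCouplings.and_iff, forSmallCouplings_const_iff hex]

/-- **CONGRUENCE**: conclusions equivalent at every bare sequence give the same FSC-keyed statement (two `ForSmallCouplings.mono`). [folklore] -/
theorem forSmallCouplings_congr {c₁ c₂ : (ℕ → ℝ) → Prop} (h : ∀ g₀, c₁ g₀ ↔ c₂ g₀) : ForSmallCouplings D c₁ ↔ ForSmallCouplings D c₂ :=
  ⟨fun h₁ => h₁.mono fun g₀ => (h g₀).1, fun h₂ => h₂.mono fun g₀ => (h g₀).2⟩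

/-- **A CONCLUSION THAT IS `g₀`-BLIND UP TO EQUIVALENCE**: if `c g₀ ↔ Q` for every `g₀`, then under endpoint existence `ForSmallCouplings D c ↔ Q`. [folklore] -/
theorem forSmallCouplings_iff_of_forall_iff {c : (ℕ → ℝ) → Prop} {Q : Prop} (hex : DagBinding.EndpointExistence D.C.toB12) (h : ∀ g₀, c g₀ ↔ Q) :
    ForSmallCouplings D c ↔ Q :=
  (forSmallCouplings_congr h).trans (forSmallCouplings_const_iff hex)

/-- **HONESTY FACE — WITHOUT THE ANTECEDENT AN FSC-KEYED FACE MAY BE VACUOUS**: `ForSmallCouplings D (fun _ => False)` holds exactly at data with no tuned sequence in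
some threshold window (`ForSmallCouplings.of_no_tuned` gives one direction), and then endpoint existence FAILS.  So every «delivery» below carries `EndpointExistence`
as a hypothesis, as v4's key does. [folklore] -/
theorem not_endpointExistence_of_forSmallCouplings_false (h : ForSmallCouplings D fun _ => False) : ¬ DagBinding.EndpointExistence D.C.toB12 :=
  fun hex => of_forSmallCouplings_const hex h

/-- … equivalently: under endpoint existence NO FSC-keyed statement is vacuous — `¬ ForSmallCouplings D (fun _ => False)`. [folklore] -/
theorem not_forSmallCouplings_false (hex : DagBinding.EndpointExistence D.C.toB12) : ¬ ForSmallCouplings D fun _ => False :=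
  fun h => not_endpointExistence_of_forSmallCouplings_false h hex

end Generic

/-! ## §2 DELIVERY: v4's FSC-keyed `KeyedRatesHolderD4` (SPELLED) ⟹ the (A3-ii) K2-junction N17 witness at every guarded admissible tuple WITH (B) ∧ endpoint existence -/

section Delivery

variable {N : ℕ} [NeZero N] (Rg : (F : T4Family) → Stage13HParams F N → Prop)

/-- ★ **THE v4 EDITION OF dag-n17-w1's JUNCTION** (`…N17AtRecord13SharedStub.n17AtRecord13Guarded_of_keyedRatesHolderD4`, which read the v2∕v3 ∀-`g₀` rates at
`(g₀, os) := (0, [])`): v4's `KeyedRatesHolderD4 β rr` SPELLED — the `PHolderD4` body under ANY tuple guard `Rg` (the skeleton's is `θ.ZhUnity F 2 ∧ θ.SlotsNondegenerate₁₃ F 2`),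
admissibility, statement (B), endpoint existence and `ForSmallCouplings (datumOfRecord₁₃CoPH F N θ hP) (fun g₀ => ∀ os, …)` — TOGETHER WITH the γ-face `(rr …).u3.γ = θ.γ`
gives, at every `Rg`-admissible ⁷ tuple AT WHICH (B) AND ENDPOINT EXISTENCE HOLD, the K2-junction sentence `∃ u, u.γ = θ.γ ∧ 0 ≤ u.ρ ∧ u.ρ < 1 ∧ N17At (datumOfRecord₁₃SepCoPH F N θ hP) u`.
Road: pull back along `Provisos₁₃SepCoPH.toCore` (`datumOfRecord₁₃SepCoPH_eq_coPH`, `rfl`), apply the keyed rates, extract ONE tuned `g₀` by endpoint existence (§1), read at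
`os := []`, witness `u := (rr F θ hP.toCore g₀ []).u3` (dag-n17-w1 `exists_u3_n17At_of_pHolderD4`).  HONEST: without the two antecedents at the tuple NOTHING follows from
v4's key (§1 honesty face). [bookkeeping] -/
theorem n17AtRecord13Guarded_of_keyedRatesHolderD4_fsc {β : ℝ}
    (rr : (F : T4Family) → (θ : Stage13HParams F N) → θ.Provisos₁₃CoPH F N → (ℕ → ℝ) → List (ULoop F) → RateCarriers N)
    (hγ : ∀ (F : T4Family) (θ : Stage13HParams F N) (hP : θ.Provisos₁₃CoPH F N) (g₀ : ℕ → ℝ) (os : List (ULoop F)), (rr F θ hP g₀ os).u3.γ = θ.γ)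
    (hr : ∀ (F : T4Family) (θ : Stage13HParams F N) (hP : θ.Provisos₁₃CoPH F N), Rg F θ → θ.Admissible F N →
      B16.EndStatementBPrinted (datumOfRecord₁₃CoPH F N θ hP).C → DagBinding.EndpointExistence (datumOfRecord₁₃CoPH F N θ hP).C.toB12 →
        ForSmallCouplings (datumOfRecord₁₃CoPH F N θ hP) fun g₀ => ∀ os : List (ULoop F),
          RatesHolderAt (datumOfRecord₁₃CoPH F N θ hP) (rr F θ hP g₀ os) β ∧ ReadOutAt (datumOfRecord₁₃CoPH F N θ hP) (rr F θ hP g₀ os).u3 ∧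
            (0 ≤ (rr F θ hP g₀ os).u3.ρ ∧ (rr F θ hP g₀ os).u3.ρ < 1)) :
    ∀ (F : T4Family) (θ : Stage13HParams F N) (hP : θ.Provisos₁₃SepCoPH F N), Rg F θ → θ.Admissible F N →
      B16.EndStatementBPrinted (datumOfRecord₁₃SepCoPH F N θ hP).C → DagBinding.EndpointExistence (datumOfRecord₁₃SepCoPH F N θ hP).C.toB12 →
        ∃ u : U3Carriers, u.γ = θ.γ ∧ 0 ≤ u.ρ ∧ u.ρ < 1 ∧ N17At (datumOfRecord₁₃SepCoPH F N θ hP) u := by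
  intro F θ hP hRg hθ hB hex
  rw [datumOfRecord₁₃SepCoPH_eq_coPH] at hB hex ⊢
  obtain ⟨g₀, hg₀⟩ := exists_of_forSmallCouplings hex (hr F θ hP.toCore hRg hθ hB hex)
  obtain ⟨u, hu, hρ0, hρ1, h17⟩ := exists_u3_n17At_of_pHolderD4 _ _ β (hg₀ [])
  exact ⟨u, hu.trans (hγ F θ hP.toCore g₀ []), hρ0, hρ1, h17⟩

/-- **… AT THE READING OF RECORD** `rr F θ hP g₀ os := rateCarriersOfRecord₁₃CoPH 𝔯 F θ hP g₀ os (ksel F θ hP g₀ os)` (= the skeleton's `rrOfRecord 𝔯 ksel`): the γ-face is `rfl`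
(node U3's box radius IS `θ.γ`), so v4's `KeyedRatesHolderD4 β (rrOfRecord 𝔯 ksel)` spelled ALONE gives the guarded sentence at the (B) ∧ endpoint tuples. [bookkeeping] -/
theorem n17AtRecord13Guarded_of_keyedRatesHolderD4_fsc_ofRecord {β : ℝ} (𝔯 : RateReading₁₃CoPH N)
    (ksel : (F : T4Family) → (θ : Stage13HParams F N) → θ.Provisos₁₃CoPH F N → (ℕ → ℝ) → List (ULoop F) → ℕ)
    (hr : ∀ (F : T4Family) (θ : Stage13HParams F N) (hP : θ.Provisos₁₃CoPH F N), Rg F θ → θ.Admissible F N →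
      B16.EndStatementBPrinted (datumOfRecord₁₃CoPH F N θ hP).C → DagBinding.EndpointExistence (datumOfRecord₁₃CoPH F N θ hP).C.toB12 →
        ForSmallCouplings (datumOfRecord₁₃CoPH F N θ hP) fun g₀ => ∀ os : List (ULoop F),
          RatesHolderAt (datumOfRecord₁₃CoPH F N θ hP) (rateCarriersOfRecord₁₃CoPH 𝔯 F θ hP g₀ os (ksel F θ hP g₀ os)) β ∧
            ReadOutAt (datumOfRecord₁₃CoPH F N θ hP) (rateCarriersOfRecord₁₃CoPH 𝔯 F θ hP g₀ os (ksel F θ hP g₀ os)).u3 ∧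
            (0 ≤ (rateCarriersOfRecord₁₃CoPH 𝔯 F θ hP g₀ os (ksel F θ hP g₀ os)).u3.ρ ∧
              (rateCarriersOfRecord₁₃CoPH 𝔯 F θ hP g₀ os (ksel F θ hP g₀ os)).u3.ρ < 1)) :
    ∀ (F : T4Family) (θ : Stage13HParams F N) (hP : θ.Provisos₁₃SepCoPH F N), Rg F θ → θ.Admissible F N →
      B16.EndStatementBPrinted (datumOfRecord₁₃SepCoPH F N θ hP).C → DagBinding.EndpointExistence (datumOfRecord₁₃SepCoPH F N θ hP).C.toB12 →
        ∃ u : U3Carriers, u.γ = θ.γ ∧ 0 ≤ u.ρ ∧ u.ρ < 1 ∧ N17At (datumOfRecord₁₃SepCoPH F N θ hP) u :=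
  n17AtRecord13Guarded_of_keyedRatesHolderD4_fsc Rg (fun F θ hP g₀ os => rateCarriersOfRecord₁₃CoPH 𝔯 F θ hP g₀ os (ksel F θ hP g₀ os))
    (fun _ _ _ _ _ => rfl) hr

/-- **… FROM THE WHOLE v4 STUB-1 SHAPE** `∃ β, 2∕3 < β ∧ β < 1 ∧ ∃ 𝔯 ksel ℓ, G 𝔯 ksel ℓ ∧ KeyedRatesHolderD4 β (rrOfRecord 𝔯 ksel)` (rates SPELLED; the guard-and-pin conjunct
`G` — the skeleton's four-conjunct `GuardedReading` — and the letter-reading type `Λ` ARBITRARY: the K2-junction sentence reads none of them). [bookkeeping] -/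
theorem n17AtRecord13Guarded_of_stub_rates13H_shape_v4 {Λ : Type*}
    (G : RateReading₁₃CoPH N → ((F : T4Family) → (θ : Stage13HParams F N) → θ.Provisos₁₃CoPH F N → (ℕ → ℝ) → List (ULoop F) → ℕ) → Λ → Prop)
    (h : ∃ β : ℝ, 2 / 3 < β ∧ β < 1 ∧
      ∃ (𝔯 : RateReading₁₃CoPH N) (ksel : (F : T4Family) → (θ : Stage13HParams F N) → θ.Provisos₁₃CoPH F N → (ℕ → ℝ) → List (ULoop F) → ℕ) (l : Λ),
        G 𝔯 ksel l ∧
        ∀ (F : T4Family) (θ : Stage13HParams F N) (hP : θ.Provisos₁₃CoPH F N), Rg F θ → θ.Admissible F N →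
          B16.EndStatementBPrinted (datumOfRecord₁₃CoPH F N θ hP).C → DagBinding.EndpointExistence (datumOfRecord₁₃CoPH F N θ hP).C.toB12 →
            ForSmallCouplings (datumOfRecord₁₃CoPH F N θ hP) fun g₀ => ∀ os : List (ULoop F),
              RatesHolderAt (datumOfRecord₁₃CoPH F N θ hP) (rateCarriersOfRecord₁₃CoPH 𝔯 F θ hP g₀ os (ksel F θ hP g₀ os)) β ∧
                ReadOutAt (datumOfRecord₁₃CoPH F N θ hP) (rateCarriersOfRecord₁₃CoPH 𝔯 F θ hP g₀ os (ksel F θ hP g₀ os)).u3 ∧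
                (0 ≤ (rateCarriersOfRecord₁₃CoPH 𝔯 F θ hP g₀ os (ksel F θ hP g₀ os)).u3.ρ ∧
                  (rateCarriersOfRecord₁₃CoPH 𝔯 F θ hP g₀ os (ksel F θ hP g₀ os)).u3.ρ < 1)) :
    ∀ (F : T4Family) (θ : Stage13HParams F N) (hP : θ.Provisos₁₃SepCoPH F N), Rg F θ → θ.Admissible F N →
      B16.EndStatementBPrinted (datumOfRecord₁₃SepCoPH F N θ hP).C → DagBinding.EndpointExistence (datumOfRecord₁₃SepCoPH F N θ hP).C.toB12 →
        ∃ u : U3Carriers, u.γ = θ.γ ∧ 0 ≤ u.ρ ∧ u.ρ < 1 ∧ N17At (datumOfRecord₁₃SepCoPH F N θ hP) u := by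
  obtain ⟨β, -, -, 𝔯, ksel, -, -, hr⟩ := h
  exact n17AtRecord13Guarded_of_keyedRatesHolderD4_fsc_ofRecord Rg 𝔯 ksel hr

end Delivery

/-! ## §3 READING: under the node-U3 pin the N17 conjunct is `g₀ ∕ os ∕ run-length`-BLIND — v4's FSC-keyed N17 slot ⟺ the BARE v3 sentence («(t9) is IDLE on N17») -/

section Pinned

variable {N : ℕ} [NeZero N]

/-- **THE N17 CONJUNCT AT THE BUNDLE OF RECORD, UNDER THE PIN AT ONE TUPLE, IS ONE BARE SENTENCE FOR ALL `(g₀, os, k)`** (dag-n17-w1 `n17At_rateCarriers_of_kernels_pin_iff`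
read at a letter READING `ℓ F θ`, the v3∕v4 `LetterReading` shape): the sentence `ScaleShiftRate ((ℓ F θ).cr·(ℓ F θ).C₅·(ℓ F θ).θ₅) (ℓ F θ).ρ θ.γ (betaOfRecord₁₃ F N θ.toStage13Params)`.
[bookkeeping] -/
theorem n17At_rrOfRecord_iff_bare_of_pin (𝔯 : RateReading₁₃CoPH N) (ℓ : (F : T4Family) → Stage13HParams F N → U3Letters₁₁) {F : T4Family} (θ : Stage13HParams F N)
    (hP : θ.Provisos₁₃CoPH F N)
    (hpin : ∀ (g₀ : ℕ → ℝ) (os : List (ULoop F)), (𝔯.lit F θ hP g₀ os).u3 = objectsOfRecord₁₃ F N θ.toStage13Params (ℓ F θ))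
    (g₀ : ℕ → ℝ) (os : List (ULoop F)) (k : ℕ) :
    N17At (datumOfRecord₁₃CoPH F N θ hP) (rateCarriersOfRecord₁₃CoPH 𝔯 F θ hP g₀ os k).u3 ↔
      ScaleShiftRate ((ℓ F θ).cr * (ℓ F θ).C₅ * (ℓ F θ).θ₅) (ℓ F θ).ρ θ.γ (betaOfRecord₁₃ F N θ.toStage13Params) :=
  n17At_rateCarriers_of_kernels_pin_iff 𝔯 θ hP g₀ os (ℓ F θ) (hpin g₀ os) k

/-- **THE ρ-LETTER UNDER THE PIN IS THE READING's `(ℓ F θ).ρ`** (`rfl` after the pin) — so v4's displayed junction letter `0 ≤ R.u3.ρ < 1` at the bundle of record is the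
`g₀`-blind sentence `0 ≤ (ℓ F θ).ρ ∧ (ℓ F θ).ρ < 1`. [bookkeeping] -/
theorem rho_rrOfRecord_eq_of_pin (𝔯 : RateReading₁₃CoPH N) (ℓ : (F : T4Family) → Stage13HParams F N → U3Letters₁₁) {F : T4Family} (θ : Stage13HParams F N)
    (hP : θ.Provisos₁₃CoPH F N)
    (hpin : ∀ (g₀ : ℕ → ℝ) (os : List (ULoop F)), (𝔯.lit F θ hP g₀ os).u3 = objectsOfRecord₁₃ F N θ.toStage13Params (ℓ F θ))
    (g₀ : ℕ → ℝ) (os : List (ULoop F)) (k : ℕ) :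
    (rateCarriersOfRecord₁₃CoPH 𝔯 F θ hP g₀ os k).u3.ρ = (ℓ F θ).ρ := by
  show (u3OfRecord₁₃ θ.toStage13Params (𝔯.lit F θ hP g₀ os).u3 k).ρ = _
  rw [hpin g₀ os]
  rfl

/-- ★★ **«(t9) IS IDLE ON N17»**: at a pinned tuple whose datum has endpoint existence, v4's FSC-KEYED N17 SLOT — `ForSmallCouplings (datumOfRecord₁₃CoPH F N θ hP) (fun g₀ =>
∀ os, N17At … (rateCarriersOfRecord₁₃CoPH 𝔯 F θ hP g₀ os (ksel F θ hP g₀ os)).u3)` — IS EQUIVALENT TO THE BARE v3 SENTENCE `ScaleShiftRate … θ.γ (betaOfRecord₁₃ …)`: the slot reads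
neither the tuning nor `os` nor the selected run length (§1 `forSmallCouplings_iff_of_forall_iff`; `→` needs endpoint existence, `←` is `ForSmallCouplings.of_forall`). [bookkeeping] -/
theorem keyedN17_fsc_iff_bare_of_pin (𝔯 : RateReading₁₃CoPH N) (ℓ : (F : T4Family) → Stage13HParams F N → U3Letters₁₁)
    (ksel : (F : T4Family) → (θ : Stage13HParams F N) → θ.Provisos₁₃CoPH F N → (ℕ → ℝ) → List (ULoop F) → ℕ) {F : T4Family} (θ : Stage13HParams F N)
    (hP : θ.Provisos₁₃CoPH F N)
    (hpin : ∀ (g₀ : ℕ → ℝ) (os : List (ULoop F)), (𝔯.lit F θ hP g₀ os).u3 = objectsOfRecord₁₃ F N θ.toStage13Params (ℓ F θ))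
    (hex : DagBinding.EndpointExistence (datumOfRecord₁₃CoPH F N θ hP).C.toB12) :
    ForSmallCouplings (datumOfRecord₁₃CoPH F N θ hP)
        (fun g₀ => ∀ os : List (ULoop F), N17At (datumOfRecord₁₃CoPH F N θ hP) (rateCarriersOfRecord₁₃CoPH 𝔯 F θ hP g₀ os (ksel F θ hP g₀ os)).u3) ↔
      ScaleShiftRate ((ℓ F θ).cr * (ℓ F θ).C₅ * (ℓ F θ).θ₅) (ℓ F θ).ρ θ.γ (betaOfRecord₁₃ F N θ.toStage13Params) := by
  refine forSmallCouplings_iff_of_forall_iff hex fun g₀ => ?_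
  constructor
  · intro h
    exact (n17At_rrOfRecord_iff_bare_of_pin 𝔯 ℓ θ hP hpin g₀ [] _).1 (h [])
  · intro h os
    exact (n17At_rrOfRecord_iff_bare_of_pin 𝔯 ℓ θ hP hpin g₀ os _).2 h

/-- **THE BARE SENTENCE FILLS v4's N17 SLOT** (no antecedent needed: `ForSmallCouplings.of_forall`) — a v3-style N17 producer at the pinned objects re-keys by this one line.
[bookkeeping] -/
theorem keyedN17_fsc_of_bare (𝔯 : RateReading₁₃CoPH N) (ℓ : (F : T4Family) → Stage13HParams F N → U3Letters₁₁)
    (ksel : (F : T4Family) → (θ : Stage13HParams F N) → θ.Provisos₁₃CoPH F N → (ℕ → ℝ) → List (ULoop F) → ℕ) {F : T4Family} (θ : Stage13HParams F N)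
    (hP : θ.Provisos₁₃CoPH F N)
    (hpin : ∀ (g₀ : ℕ → ℝ) (os : List (ULoop F)), (𝔯.lit F θ hP g₀ os).u3 = objectsOfRecord₁₃ F N θ.toStage13Params (ℓ F θ))
    (h : ScaleShiftRate ((ℓ F θ).cr * (ℓ F θ).C₅ * (ℓ F θ).θ₅) (ℓ F θ).ρ θ.γ (betaOfRecord₁₃ F N θ.toStage13Params)) :
    ForSmallCouplings (datumOfRecord₁₃CoPH F N θ hP)
      fun g₀ => ∀ os : List (ULoop F), N17At (datumOfRecord₁₃CoPH F N θ hP) (rateCarriersOfRecord₁₃CoPH 𝔯 F θ hP g₀ os (ksel F θ hP g₀ os)).u3 :=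
  ForSmallCouplings.of_forall fun g₀ os => (n17At_rrOfRecord_iff_bare_of_pin 𝔯 ℓ θ hP hpin g₀ os _).2 h

variable (Rg : (F : T4Family) → Stage13HParams F N → Prop)

/-- ★ **WHAT v4's KEYED RATES DELIVER TO N17's CONSUMERS UNDER THE PIN: THE BARE SENTENCE AT EVERY GUARDED ADMISSIBLE TUPLE WITH (B) ∧ ENDPOINT EXISTENCE** — v4's
`KeyedRatesHolderD4 β (rrOfRecord 𝔯 ksel)` SPELLED (guard `Rg` arbitrary) and the node-U3 pin `U3PinnedKernels 𝔯 ℓ` SPELLED ⟹ `ScaleShiftRate ((ℓ F θ).cr·(ℓ F θ).C₅·(ℓ F θ).θ₅)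
(ℓ F θ).ρ θ.γ (betaOfRecord₁₃ F N θ.toStage13Params)` AND the junction letter `0 ≤ (ℓ F θ).ρ < 1`.  Road: the N17 conjunct (fourth of `RatesHolderAt`) and the ρ-letter of the
FSC-keyed body are `g₀`-blind under the pin (§3), so §1's const face applies at the one tuned `g₀` endpoint existence supplies. [bookkeeping] -/
theorem scaleShiftRate_betaOfRecord₁₃_of_keyedRatesHolderD4_fsc_pin {β : ℝ} (𝔯 : RateReading₁₃CoPH N) (ℓ : (F : T4Family) → Stage13HParams F N → U3Letters₁₁)
    (ksel : (F : T4Family) → (θ : Stage13HParams F N) → θ.Provisos₁₃CoPH F N → (ℕ → ℝ) → List (ULoop F) → ℕ)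
    (hpin : ∀ (F : T4Family) (θ : Stage13HParams F N) (hP : θ.Provisos₁₃CoPH F N) (g₀ : ℕ → ℝ) (os : List (ULoop F)),
      (𝔯.lit F θ hP g₀ os).u3 = objectsOfRecord₁₃ F N θ.toStage13Params (ℓ F θ))
    (hr : ∀ (F : T4Family) (θ : Stage13HParams F N) (hP : θ.Provisos₁₃CoPH F N), Rg F θ → θ.Admissible F N →
      B16.EndStatementBPrinted (datumOfRecord₁₃CoPH F N θ hP).C → DagBinding.EndpointExistence (datumOfRecord₁₃CoPH F N θ hP).C.toB12 →
        ForSmallCouplings (datumOfRecord₁₃CoPH F N θ hP) fun g₀ => ∀ os : List (ULoop F),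
          RatesHolderAt (datumOfRecord₁₃CoPH F N θ hP) (rateCarriersOfRecord₁₃CoPH 𝔯 F θ hP g₀ os (ksel F θ hP g₀ os)) β ∧
            ReadOutAt (datumOfRecord₁₃CoPH F N θ hP) (rateCarriersOfRecord₁₃CoPH 𝔯 F θ hP g₀ os (ksel F θ hP g₀ os)).u3 ∧
            (0 ≤ (rateCarriersOfRecord₁₃CoPH 𝔯 F θ hP g₀ os (ksel F θ hP g₀ os)).u3.ρ ∧
              (rateCarriersOfRecord₁₃CoPH 𝔯 F θ hP g₀ os (ksel F θ hP g₀ os)).u3.ρ < 1))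
    (F : T4Family) (θ : Stage13HParams F N) (hP : θ.Provisos₁₃CoPH F N) (hRg : Rg F θ) (hθ : θ.Admissible F N)
    (hB : B16.EndStatementBPrinted (datumOfRecord₁₃CoPH F N θ hP).C) (hex : DagBinding.EndpointExistence (datumOfRecord₁₃CoPH F N θ hP).C.toB12) :
    ScaleShiftRate ((ℓ F θ).cr * (ℓ F θ).C₅ * (ℓ F θ).θ₅) (ℓ F θ).ρ θ.γ (betaOfRecord₁₃ F N θ.toStage13Params) ∧ (0 ≤ (ℓ F θ).ρ ∧ (ℓ F θ).ρ < 1) := by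
  obtain ⟨g₀, hg₀⟩ := exists_of_forSmallCouplings hex (hr F θ hP hRg hθ hB hex)
  obtain ⟨hrates, -, hρ⟩ := hg₀ []
  refine ⟨(n17At_rrOfRecord_iff_bare_of_pin 𝔯 ℓ θ hP (hpin F θ hP) g₀ [] _).1 hrates.2.2.2.1, ?_⟩
  rwa [rho_rrOfRecord_eq_of_pin 𝔯 ℓ θ hP (hpin F θ hP) g₀ []] at hρ

/-- ★★ **WHAT v4's WHOLE STUB-1 SHAPE DELIVERS TO N17's CONSUMERS** (K2⁷ V6's `RunRemAt` road, node U2): from `∃ β, 2∕3 < β ∧ β < 1 ∧ ∃ 𝔯 ksel ℓ, G 𝔯 ksel ℓ ∧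
KeyedRatesHolderD4 β (rrOfRecord 𝔯 ksel)` (rates SPELLED, `G` ARBITRARY but IMPLYING the node-U3 pin — v4's `GuardedReading` does, by its fourth conjunct `.2.2.2`) one gets SOME
letter reading `ℓ` such that at every `Rg`-admissible tuple with (B) ∧ endpoint existence the BARE NE4 sentence for `betaOfRecord₁₃` holds with `ℓ`'s constant `cr·C₅·θ₅`,
rate `ρ ∈ [0, 1[` and box radius `θ.γ`.  This is the v4 price list of node N17's output: the two antecedents, nothing in the tuning. [bookkeeping] -/
theorem exists_letters_scaleShiftRate_of_stub_rates13H_shape_v4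
    (G : RateReading₁₃CoPH N → ((F : T4Family) → (θ : Stage13HParams F N) → θ.Provisos₁₃CoPH F N → (ℕ → ℝ) → List (ULoop F) → ℕ) →
      ((F : T4Family) → Stage13HParams F N → U3Letters₁₁) → Prop)
    (hG : ∀ 𝔯 ksel ℓ, G 𝔯 ksel ℓ → ∀ (F : T4Family) (θ : Stage13HParams F N) (hP : θ.Provisos₁₃CoPH F N) (g₀ : ℕ → ℝ) (os : List (ULoop F)),
      (𝔯.lit F θ hP g₀ os).u3 = objectsOfRecord₁₃ F N θ.toStage13Params (ℓ F θ))
    (h : ∃ β : ℝ, 2 / 3 < β ∧ β < 1 ∧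
      ∃ (𝔯 : RateReading₁₃CoPH N) (ksel : (F : T4Family) → (θ : Stage13HParams F N) → θ.Provisos₁₃CoPH F N → (ℕ → ℝ) → List (ULoop F) → ℕ)
        (ℓ : (F : T4Family) → Stage13HParams F N → U3Letters₁₁),
        G 𝔯 ksel ℓ ∧
        ∀ (F : T4Family) (θ : Stage13HParams F N) (hP : θ.Provisos₁₃CoPH F N), Rg F θ → θ.Admissible F N →
          B16.EndStatementBPrinted (datumOfRecord₁₃CoPH F N θ hP).C → DagBinding.EndpointExistence (datumOfRecord₁₃CoPH F N θ hP).C.toB12 →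
            ForSmallCouplings (datumOfRecord₁₃CoPH F N θ hP) fun g₀ => ∀ os : List (ULoop F),
              RatesHolderAt (datumOfRecord₁₃CoPH F N θ hP) (rateCarriersOfRecord₁₃CoPH 𝔯 F θ hP g₀ os (ksel F θ hP g₀ os)) β ∧
                ReadOutAt (datumOfRecord₁₃CoPH F N θ hP) (rateCarriersOfRecord₁₃CoPH 𝔯 F θ hP g₀ os (ksel F θ hP g₀ os)).u3 ∧
                (0 ≤ (rateCarriersOfRecord₁₃CoPH 𝔯 F θ hP g₀ os (ksel F θ hP g₀ os)).u3.ρ ∧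
                  (rateCarriersOfRecord₁₃CoPH 𝔯 F θ hP g₀ os (ksel F θ hP g₀ os)).u3.ρ < 1)) :
    ∃ ℓ : (F : T4Family) → Stage13HParams F N → U3Letters₁₁,
      ∀ (F : T4Family) (θ : Stage13HParams F N) (hP : θ.Provisos₁₃CoPH F N), Rg F θ → θ.Admissible F N →
        B16.EndStatementBPrinted (datumOfRecord₁₃CoPH F N θ hP).C → DagBinding.EndpointExistence (datumOfRecord₁₃CoPH F N θ hP).C.toB12 →
          ScaleShiftRate ((ℓ F θ).cr * (ℓ F θ).C₅ * (ℓ F θ).θ₅) (ℓ F θ).ρ θ.γ (betaOfRecord₁₃ F N θ.toStage13Params) ∧ (0 ≤ (ℓ F θ).ρ ∧ (ℓ F θ).ρ < 1) := by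
  obtain ⟨β, -, -, 𝔯, ksel, ℓ, hg, hr⟩ := h
  exact ⟨ℓ, scaleShiftRate_betaOfRecord₁₃_of_keyedRatesHolderD4_fsc_pin Rg 𝔯 ℓ ksel (hG 𝔯 ksel ℓ hg) hr⟩

/-- **… READ AT THE ⁷ DATUM** `datumOfRecord₁₃SepCoPH F N θ hP` (the item's key; `rfl` bridge `datumOfRecord₁₃SepCoPH_eq_coPH`): the bare sentence is literally
`N17At (datumOfRecord₁₃SepCoPH F N θ hP) u` at the carriers `u := u3OfRecord₁₃ θ.toStage13Params (objectsOfRecord₁₃ F N θ.toStage13Params (ℓ F θ)) 0` (dag-n17-w1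
`n17At_objectsOfRecord₁₃_datumOfRecord₁₃SepCoPH_iff`, `Iff.rfl`) — so the delivery above IS an N17 witness at the ⁷ datum with `u.γ = θ.γ` (`rfl`). [bookkeeping] -/
theorem n17At_sepCoPH_objectsOfRecord₁₃_of_bare (ℓ : (F : T4Family) → Stage13HParams F N → U3Letters₁₁) {F : T4Family} (θ : Stage13HParams F N)
    (hP : θ.Provisos₁₃SepCoPH F N) (h : ScaleShiftRate ((ℓ F θ).cr * (ℓ F θ).C₅ * (ℓ F θ).θ₅) (ℓ F θ).ρ θ.γ (betaOfRecord₁₃ F N θ.toStage13Params)) :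
    N17At (datumOfRecord₁₃SepCoPH F N θ hP) (u3OfRecord₁₃ θ.toStage13Params (objectsOfRecord₁₃ F N θ.toStage13Params (ℓ F θ)) 0) :=
  (YMDAG.N17.AtU3OfKernels.n17At_objectsOfRecord₁₃_datumOfRecord₁₃SepCoPH_iff θ hP (ℓ F θ) 0).2 h

end Pinned

/-! ## §4 (EDITION v1.1, append-only) EDITION-PROOF FORMS: ANY FSC-keyed rates predicate `P` projecting to the N17 conjunct and the ρ-letter
(v4's `PHolderD4` is one instance; a successor skeleton that re-pins N14 ∕ N15 ∕ N16 but keeps `N17At D R.u3 ∧ (0 ≤ R.u3.ρ ∧ R.u3.ρ < 1)` in its rates body is another —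
§2 ∕ §3 then follow by ONE application, with no re-keyed edition of this file) -/

section Generic

variable {N : ℕ} [NeZero N] (Rg : (F : T4Family) → Stage13HParams F N → Prop) (P : ∀ {F : T4Family}, Datum F N → RateCarriers N → Prop)

/-- ★ **DELIVERY FROM ANY FSC-KEYED `P` PROJECTING TO `N17At D R.u3 ∧ (0 ≤ R.u3.ρ ∧ R.u3.ρ < 1)`** (guard `Rg`, reading `rr` with the γ-face arbitrary): at every `Rg`-admissible ⁷ tuple
with (B) ∧ endpoint existence, the K2-junction sentence `∃ u, u.γ = θ.γ ∧ 0 ≤ u.ρ ∧ u.ρ < 1 ∧ N17At (datumOfRecord₁₃SepCoPH F N θ hP) u` (§2's road with the projection in place of the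
spelled body; §2's ★ is the instance `P := PHolderD4 β` body, projection `fun h => ⟨h.1.2.2.2.1, h.2.2⟩`). [bookkeeping] -/
theorem n17AtRecord13Guarded_of_keyedP_fsc (hproj : ∀ {F : T4Family} (D : Datum F N) (R : RateCarriers N), P D R → N17At D R.u3 ∧ (0 ≤ R.u3.ρ ∧ R.u3.ρ < 1))
    (rr : (F : T4Family) → (θ : Stage13HParams F N) → θ.Provisos₁₃CoPH F N → (ℕ → ℝ) → List (ULoop F) → RateCarriers N)
    (hγ : ∀ (F : T4Family) (θ : Stage13HParams F N) (hP : θ.Provisos₁₃CoPH F N) (g₀ : ℕ → ℝ) (os : List (ULoop F)), (rr F θ hP g₀ os).u3.γ = θ.γ)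
    (hr : ∀ (F : T4Family) (θ : Stage13HParams F N) (hP : θ.Provisos₁₃CoPH F N), Rg F θ → θ.Admissible F N →
      B16.EndStatementBPrinted (datumOfRecord₁₃CoPH F N θ hP).C → DagBinding.EndpointExistence (datumOfRecord₁₃CoPH F N θ hP).C.toB12 →
        ForSmallCouplings (datumOfRecord₁₃CoPH F N θ hP) fun g₀ => ∀ os : List (ULoop F), P (datumOfRecord₁₃CoPH F N θ hP) (rr F θ hP g₀ os)) :
    ∀ (F : T4Family) (θ : Stage13HParams F N) (hP : θ.Provisos₁₃SepCoPH F N), Rg F θ → θ.Admissible F N →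
      B16.EndStatementBPrinted (datumOfRecord₁₃SepCoPH F N θ hP).C → DagBinding.EndpointExistence (datumOfRecord₁₃SepCoPH F N θ hP).C.toB12 →
        ∃ u : U3Carriers, u.γ = θ.γ ∧ 0 ≤ u.ρ ∧ u.ρ < 1 ∧ N17At (datumOfRecord₁₃SepCoPH F N θ hP) u := by
  intro F θ hP hRg hθ hB hex
  rw [datumOfRecord₁₃SepCoPH_eq_coPH] at hB hex ⊢
  obtain ⟨g₀, hg₀⟩ := exists_of_forSmallCouplings hex (hr F θ hP.toCore hRg hθ hB hex)
  obtain ⟨h17, hρ0, hρ1⟩ := hproj _ _ (hg₀ [])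
  exact ⟨(rr F θ hP.toCore g₀ []).u3, hγ F θ hP.toCore g₀ [], hρ0, hρ1, h17⟩

/-- ★ **READING FROM ANY FSC-KEYED `P` PROJECTING TO THE N17 CONJUNCT AND THE ρ-LETTER, UNDER THE NODE-U3 PIN**: at every `Rg`-admissible CoPH tuple with (B) ∧ endpoint existence,
the BARE sentence `ScaleShiftRate ((ℓ F θ).cr·(ℓ F θ).C₅·(ℓ F θ).θ₅) (ℓ F θ).ρ θ.γ (betaOfRecord₁₃ F N θ.toStage13Params)` and `0 ≤ (ℓ F θ).ρ < 1` (§3's ★ is the `PHolderD4` instance).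
[bookkeeping] -/
theorem scaleShiftRate_betaOfRecord₁₃_of_keyedP_fsc_pin
    (hproj : ∀ {F : T4Family} (D : Datum F N) (R : RateCarriers N), P D R → N17At D R.u3 ∧ (0 ≤ R.u3.ρ ∧ R.u3.ρ < 1))
    (𝔯 : RateReading₁₃CoPH N) (ℓ : (F : T4Family) → Stage13HParams F N → U3Letters₁₁)
    (ksel : (F : T4Family) → (θ : Stage13HParams F N) → θ.Provisos₁₃CoPH F N → (ℕ → ℝ) → List (ULoop F) → ℕ)
    (hpin : ∀ (F : T4Family) (θ : Stage13HParams F N) (hP : θ.Provisos₁₃CoPH F N) (g₀ : ℕ → ℝ) (os : List (ULoop F)),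
      (𝔯.lit F θ hP g₀ os).u3 = objectsOfRecord₁₃ F N θ.toStage13Params (ℓ F θ))
    (hr : ∀ (F : T4Family) (θ : Stage13HParams F N) (hP : θ.Provisos₁₃CoPH F N), Rg F θ → θ.Admissible F N →
      B16.EndStatementBPrinted (datumOfRecord₁₃CoPH F N θ hP).C → DagBinding.EndpointExistence (datumOfRecord₁₃CoPH F N θ hP).C.toB12 →
        ForSmallCouplings (datumOfRecord₁₃CoPH F N θ hP) fun g₀ => ∀ os : List (ULoop F),
          P (datumOfRecord₁₃CoPH F N θ hP) (rateCarriersOfRecord₁₃CoPH 𝔯 F θ hP g₀ os (ksel F θ hP g₀ os)))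
    (F : T4Family) (θ : Stage13HParams F N) (hP : θ.Provisos₁₃CoPH F N) (hRg : Rg F θ) (hθ : θ.Admissible F N)
    (hB : B16.EndStatementBPrinted (datumOfRecord₁₃CoPH F N θ hP).C) (hex : DagBinding.EndpointExistence (datumOfRecord₁₃CoPH F N θ hP).C.toB12) :
    ScaleShiftRate ((ℓ F θ).cr * (ℓ F θ).C₅ * (ℓ F θ).θ₅) (ℓ F θ).ρ θ.γ (betaOfRecord₁₃ F N θ.toStage13Params) ∧ (0 ≤ (ℓ F θ).ρ ∧ (ℓ F θ).ρ < 1) := by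
  obtain ⟨g₀, hg₀⟩ := exists_of_forSmallCouplings hex (hr F θ hP hRg hθ hB hex)
  obtain ⟨h17, hρ⟩ := hproj _ _ (hg₀ [])
  refine ⟨(n17At_rrOfRecord_iff_bare_of_pin 𝔯 ℓ θ hP (hpin F θ hP) g₀ [] _).1 h17, ?_⟩
  rwa [rho_rrOfRecord_eq_of_pin 𝔯 ℓ θ hP (hpin F θ hP) g₀ []] at hρ

/-- **v4's `PHolderD4` IS SUCH A `P`** (the projection `fun h => ⟨h.1.2.2.2.1, h.2.2⟩`): §3's ★ re-derived from the edition-proof form in one line — the sanity check that the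
generic road loses nothing. [bookkeeping] -/
theorem scaleShiftRate_betaOfRecord₁₃_of_keyedRatesHolderD4_fsc_pin' {β : ℝ} (𝔯 : RateReading₁₃CoPH N) (ℓ : (F : T4Family) → Stage13HParams F N → U3Letters₁₁)
    (ksel : (F : T4Family) → (θ : Stage13HParams F N) → θ.Provisos₁₃CoPH F N → (ℕ → ℝ) → List (ULoop F) → ℕ)
    (hpin : ∀ (F : T4Family) (θ : Stage13HParams F N) (hP : θ.Provisos₁₃CoPH F N) (g₀ : ℕ → ℝ) (os : List (ULoop F)),
      (𝔯.lit F θ hP g₀ os).u3 = objectsOfRecord₁₃ F N θ.toStage13Params (ℓ F θ))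
    (hr : ∀ (F : T4Family) (θ : Stage13HParams F N) (hP : θ.Provisos₁₃CoPH F N), Rg F θ → θ.Admissible F N →
      B16.EndStatementBPrinted (datumOfRecord₁₃CoPH F N θ hP).C → DagBinding.EndpointExistence (datumOfRecord₁₃CoPH F N θ hP).C.toB12 →
        ForSmallCouplings (datumOfRecord₁₃CoPH F N θ hP) fun g₀ => ∀ os : List (ULoop F),
          RatesHolderAt (datumOfRecord₁₃CoPH F N θ hP) (rateCarriersOfRecord₁₃CoPH 𝔯 F θ hP g₀ os (ksel F θ hP g₀ os)) β ∧
            ReadOutAt (datumOfRecord₁₃CoPH F N θ hP) (rateCarriersOfRecord₁₃CoPH 𝔯 F θ hP g₀ os (ksel F θ hP g₀ os)).u3 ∧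
            (0 ≤ (rateCarriersOfRecord₁₃CoPH 𝔯 F θ hP g₀ os (ksel F θ hP g₀ os)).u3.ρ ∧
              (rateCarriersOfRecord₁₃CoPH 𝔯 F θ hP g₀ os (ksel F θ hP g₀ os)).u3.ρ < 1))
    (F : T4Family) (θ : Stage13HParams F N) (hP : θ.Provisos₁₃CoPH F N) (hRg : Rg F θ) (hθ : θ.Admissible F N)
    (hB : B16.EndStatementBPrinted (datumOfRecord₁₃CoPH F N θ hP).C) (hex : DagBinding.EndpointExistence (datumOfRecord₁₃CoPH F N θ hP).C.toB12) :
    ScaleShiftRate ((ℓ F θ).cr * (ℓ F θ).C₅ * (ℓ F θ).θ₅) (ℓ F θ).ρ θ.γ (betaOfRecord₁₃ F N θ.toStage13Params) ∧ (0 ≤ (ℓ F θ).ρ ∧ (ℓ F θ).ρ < 1) :=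
  scaleShiftRate_betaOfRecord₁₃_of_keyedP_fsc_pin Rg (fun D R => RatesHolderAt D R β ∧ ReadOutAt D R.u3 ∧ (0 ≤ R.u3.ρ ∧ R.u3.ρ < 1))
    (fun _ _ h => ⟨h.1.2.2.2.1, h.2.2⟩) 𝔯 ℓ ksel hpin hr F θ hP hRg hθ hB hex

end Generic

end YMDAG.N17.KeyedRatesFSC
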